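import Summits.CriticalPhenomena.PercolationContinuityZ3.Theorems.PercNearOneGluingNoHeavyQuantSDEC
import HarnessLib

/-!
# QUANT lane R8, heavy node: the phantom is q-FREE — the GATE-UNIFORM certificate principle
# `LawDec.gate_lconv_row_of_universalCertificate`

builds on p205010 (kernel theorem, internal audit signed; external expert review pending)

Support file (`--supports stmt-CriticalPhenomena-4575`), QUANT lane typer seat prim-quant-stmt (gen 34), rung R8; memo
`run/shared/lean/prim/quant/prim-quant-stmt-g34/PHANTOM-QFREE-G34.md`.  Theorems only, standard axioms, no sorries.  Imports only
`…QuantSDEC` (`LawDec.gate`, `LawDec.lconv`) so that it elaborates ahead of the farm backlog; the test-function bookkeeping of arm-2 g38's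
unbuilt `…QuantTwoLayerCertificate` (`sum_fun_mul_lconv` / `sum_fun_mul_gate`) is inlined as local `have`s.  Hypotheses / conclusion are the LITERAL
unfoldings of `LawDec.TLB (y/(1−y)) (q·Tᵢ) Mᵢ (gate μᵢ q)` (`…QuantTLBClosure`) resp. of row `d = k` of `LawDec.TLBGateConvClosedHeavy`'s
conclusion (`…QuantTLBClosureHeavy`, ⧗ p376241).

THE OBSERVATION (typer g34).  In the tensor-certificate LP for row `k` of the gated product (arm-2 g38's principle, lead g37 N15–N18) every
constraint is AFFINE in the phantom `ε = u(1−q)/q` (`u = y/(1−y)`): a gated factor row reads `E[h¹_c(X₁)] ≥ ε` with the UNGATED functional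
`h¹_c(a) = [a ≥ t₁ − c] − u·[a ≤ c]`, the means are `Tᵢ = tᵢ(1 + ε/u)`, the target is `E[K⁰(X₁+X₂)] ≥ ε`, `K⁰(n) = [n ≥ t − k] − u·[n ≤ k]`,
`t = t₁ + t₂ = q(T₁+T₂)`.  Hence ONE set of weights `λ s c, κ a c ≥ 0` and free tilts `ρ₁ s, ρ₂ a` proves the row for EVERY gate as soon as
**(E0)** `Σ_c λ s c·h¹_c(a) + Σ_c κ a c·h²_c(s) + ρ₁ s·(a − t₁) + ρ₂ a·(s − t₂) ≤ K⁰(a+s)` on `{0..M₁}×{0..M₂}` (a certificate for Theorem A's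
UNGATED problem with mean tilts around the targets) and **(E1)** YIELD `Σ_c λ s c + Σ_c κ a c + (t₁/u)ρ₁ s + (t₂/u)ρ₂ a ≥ 1` at every cell
(each unit of weight earns the factor's spare `ε`, each tilt earns `ρ·tᵢε/u`).  'Theorem B' := (E0)+(E1) feasible for all `u ≥ 1`, `tᵢ > 0`,
`Mᵢ ≤ tᵢ(1+1/u)`, `2k < t` — EXACT LP evidence 480/480 (typer g34 `explore/ucc.py`; `u` up to 9, `t ≤ 6`, both orientations) + 240/240
(`explore/allq.py`); Theorem B ⟹ every row of `TLBGateConvClosedHeavy` at every gate (this file) and, at `q = 1`, Theorem A under TA.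
HONEST STATUS: a proof DEVICE; `TLBGateConvClosedHeavy`, `FarTreeRowHeavy`, `FarTreeRow` OPEN; nothing here is a published result; RATE
class log\* / honest sentence of `run/shared/lean/prim/quant/README.md` unchanged.

[this work]; fixed-gate principle: prim-quant-arm-2 g38 (`twoLayer_pair_of_certificate`).  The gluing rows served
[cite: KozmaNitzan2024, Conjecture 3 (p. 15)]; product measure [cite: Grimmett1999, §1.3 p. 10].
-/

noncomputable section

namespace Summit.CriticalPhenomena.PercolationContinuityZ3.Theorems

namespace Quant

open Finset

namespace LawDec

/-! ### Bookkeeping -/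

/-- a partial sum of a law vanishing above `M` as an indicator sum over `{0..M}`. [this work] -/
theorem sum_range_succ_eq_sum_ite (M d : ℕ) (ν : ℕ → ℝ) (hz : ∀ h, M < h → ν h = 0) :
    ∑ h ∈ Finset.range (d + 1), ν h = ∑ h ∈ Finset.range (M + 1), (if h ≤ d then ν h else 0) := by
  rcases Nat.lt_or_ge M d with hMd | hdM
  swap
  · rw [← Finset.sum_range_add_sum_Ico _ (Nat.succ_le_succ hdM)]
    have h1 : ∑ h ∈ Finset.range (d + 1), (if h ≤ d then ν h else 0) = ∑ h ∈ Finset.range (d + 1), ν h :=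
      Finset.sum_congr rfl fun h hh => by rw [Finset.mem_range] at hh; rw [if_pos (Nat.lt_succ_iff.mp hh)]
    have h2 : ∑ h ∈ Finset.Ico (d + 1) (M + 1), (if h ≤ d then ν h else 0) = 0 :=
      Finset.sum_eq_zero fun h hh => by rw [Finset.mem_Ico] at hh; rw [if_neg (by omega)]
    rw [h1, h2, add_zero]
  · rw [← Finset.sum_range_add_sum_Ico _ (Nat.succ_le_succ hMd.le)]
    have h1 : ∑ h ∈ Finset.range (M + 1), (if h ≤ d then ν h else 0) = ∑ h ∈ Finset.range (M + 1), ν h :=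
      Finset.sum_congr rfl fun h hh => by rw [Finset.mem_range] at hh; rw [if_pos (by omega)]
    have h2 : ∑ h ∈ Finset.Ico (M + 1) (d + 1), ν h = 0 :=
      Finset.sum_eq_zero fun h hh => by rw [Finset.mem_Ico] at hh; exact hz h (by omega)
    rw [h1, h2, add_zero]

/-! ### A gated two-layer row in functional form -/

/-- **row `c` of the gated two-layer bound, functional form.**  For a law `μ` vanishing above `M`, a gate `q` and a target `t` with
`2c < t`: if `u·Σ_{h ≤ c} gate μ q h ≤ Σ_{h ≤ M, t − c ≤ h} gate μ q h` then `u·(1 − q) ≤ q·Σ_{h ≤ M} μ h·([t − c ≤ h] − u·[h ≤ c])`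
(the phantom zero `1 − q` lies in every low set and in no claim set). [this work] -/
theorem gate_row_functional (u q t : ℝ) (M c : ℕ) (μ : ℕ → ℝ) (hz : ∀ h, M < h → μ h = 0) (hc : 2 * (c : ℝ) < t)
    (hrow : u * ∑ h ∈ Finset.range (c + 1), gate μ q h ≤ ∑ h ∈ Finset.range (M + 1), (if t - c ≤ (h : ℝ) then gate μ q h else 0)) :
    u * (1 - q) ≤ q * ∑ h ∈ Finset.range (M + 1),
      μ h * ((if t - c ≤ (h : ℝ) then (1 : ℝ) else 0) - u * (if h ≤ c then (1 : ℝ) else 0)) := by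
  -- test functions against a gated law (arm-2 g38's `sum_fun_mul_gate`, inlined while its module is unbuilt on the farm)
  have sum_gate_test : ∀ (Mx : ℕ) (μx : ℕ → ℝ) (φ : ℕ → ℝ),
      ∑ h ∈ Finset.range (Mx + 1), φ h * gate μx q h = q * ∑ h ∈ Finset.range (Mx + 1), φ h * μx h + (1 - q) * φ 0 := by
    intro Mx μx φ; simp only [gate]
    have e : ∀ h : ℕ, φ h * (q * μx h + (if h = 0 then 1 - q else 0))
        = q * (φ h * μx h) + (if h = 0 then (1 - q) * φ 0 else 0) := by
      intro h; by_cases hh : h = 0 <;> simp [hh] <;> ring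
    simp_rw [e]
    rw [Finset.sum_add_distrib, ← Finset.mul_sum, Finset.sum_ite_eq' (Finset.range (Mx + 1)) 0,
      if_pos (Finset.mem_range.2 (Nat.succ_pos Mx))]
  have hzg : ∀ h, M < h → gate μ q h = 0 := fun h hh => by simp only [gate]; rw [hz h hh, if_neg (by omega)]; ring
  rw [sum_range_succ_eq_sum_ite M c (gate μ q) hzg] at hrow
  -- both sides of `hrow` as test functions against `gate μ q`
  have eL : ∑ h ∈ Finset.range (M + 1), (if h ≤ c then gate μ q h else 0)
      = ∑ h ∈ Finset.range (M + 1), (if h ≤ c then (1 : ℝ) else 0) * gate μ q h :=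
    Finset.sum_congr rfl fun h _ => by split_ifs <;> simp
  have eR : ∑ h ∈ Finset.range (M + 1), (if t - c ≤ (h : ℝ) then gate μ q h else 0)
      = ∑ h ∈ Finset.range (M + 1), (if t - c ≤ (h : ℝ) then (1 : ℝ) else 0) * gate μ q h :=
    Finset.sum_congr rfl fun h _ => by split_ifs <;> simp
  rw [eL, sum_gate_test] at hrow
  rw [eR, sum_gate_test] at hrow
  have hc0 : (0 : ℝ) ≤ c := Nat.cast_nonneg c
  simp only [Nat.cast_zero] at hrow
  rw [if_pos (Nat.zero_le c), if_neg (by linarith)] at hrow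
  have e : q * ∑ h ∈ Finset.range (M + 1), μ h * ((if t - c ≤ (h : ℝ) then (1 : ℝ) else 0) - u * (if h ≤ c then (1 : ℝ) else 0))
      = q * ∑ h ∈ Finset.range (M + 1), (if t - c ≤ (h : ℝ) then (1 : ℝ) else 0) * μ h
        - u * (q * ∑ h ∈ Finset.range (M + 1), (if h ≤ c then (1 : ℝ) else 0) * μ h) := by
    rw [Finset.mul_sum, Finset.mul_sum, Finset.mul_sum, Finset.mul_sum, ← Finset.sum_sub_distrib]
    exact Finset.sum_congr rfl fun h _ => by ring
  rw [e]
  linarith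

/-! ### The gate-uniform principle -/

/-- **THE GATE-UNIFORM (q-FREE) CERTIFICATE PRINCIPLE** (typer g34).  Floor `0 < y < 1` (`u := y/(1−y)`), gate `0 < q ≤ 1`; probability laws
`μ₁`, `μ₂` on `{0..M₁}`, `{0..M₂}` (nonnegative, vanishing above `Mᵢ`, mass `1`) with GATED targets `t₁ = q·T₁`, `t₂ = q·T₂` (`Tᵢ` the means)
whose gated laws satisfy the two-layer-bound rows (`hB1`, `hB2`: literally `LawDec.TLB (y/(1−y)) tᵢ Mᵢ (gate μᵢ q)` unfolded); a layer `k`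
with `2k < t₁ + t₂`.  GIVEN `lam kap : ℕ → ℕ → ℝ` (nonnegative; `0 < lam s c → 2c < t₁`, `0 < kap a c → 2c < t₂`) and free tilts
`ρ₁ ρ₂ : ℕ → ℝ` satisfying, at every cell `a ≤ M₁`, `s ≤ M₂`,
**(E0)** `Σ_{c ≤ M₁} lam s c·([t₁ − c ≤ a] − u[a ≤ c]) + Σ_{c ≤ M₂} kap a c·([t₂ − c ≤ s] − u[s ≤ c]) + ρ₁ s·(a − t₁) + ρ₂ a·(s − t₂)
  ≤ [t₁ + t₂ − k ≤ a + s] − u·[a + s ≤ k]` and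
**(E1)** `1 ≤ Σ_{c ≤ M₁} lam s c + Σ_{c ≤ M₂} kap a c + ((1−y)/y)·t₁·ρ₁ s + ((1−y)/y)·t₂·ρ₂ a`,
row `k` of the two-layer bound of the gated convolution holds:
`u·Σ_{h ≤ k} gate (lconv μ₁ μ₂) q h ≤ Σ_{h ≤ M₁+M₂, t₁+t₂−k ≤ h} gate (lconv μ₁ μ₂) q h`.  The data do not mention `q`: ONE certificate serves
every gate. [this work] -/
theorem gate_lconv_row_of_universalCertificate (y q t₁ t₂ : ℝ) (M₁ M₂ k : ℕ) (μ₁ μ₂ : ℕ → ℝ)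
    (hy0 : 0 < y) (hy1 : y < 1) (hq0 : 0 < q) (hq1 : q ≤ 1)
    (n1 : ∀ h, 0 ≤ μ₁ h) (z1 : ∀ h, M₁ < h → μ₁ h = 0) (s1 : ∑ h ∈ Finset.range (M₁ + 1), μ₁ h = 1)
    (n2 : ∀ h, 0 ≤ μ₂ h) (z2 : ∀ h, M₂ < h → μ₂ h = 0) (s2 : ∑ h ∈ Finset.range (M₂ + 1), μ₂ h = 1)
    (ht1 : t₁ = q * ∑ h ∈ Finset.range (M₁ + 1), (h : ℝ) * μ₁ h)
    (ht2 : t₂ = q * ∑ h ∈ Finset.range (M₂ + 1), (h : ℝ) * μ₂ h)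
    (hk : 2 * (k : ℝ) < t₁ + t₂)
    (hB1 : ∀ d : ℕ, 2 * (d : ℝ) < t₁ →
      y / (1 - y) * ∑ h ∈ Finset.range (d + 1), gate μ₁ q h
        ≤ ∑ h ∈ Finset.range (M₁ + 1), (if t₁ - d ≤ (h : ℝ) then gate μ₁ q h else 0))
    (hB2 : ∀ d : ℕ, 2 * (d : ℝ) < t₂ →
      y / (1 - y) * ∑ h ∈ Finset.range (d + 1), gate μ₂ q h
        ≤ ∑ h ∈ Finset.range (M₂ + 1), (if t₂ - d ≤ (h : ℝ) then gate μ₂ q h else 0))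
    (lam kap : ℕ → ℕ → ℝ) (ρ₁ ρ₂ : ℕ → ℝ)
    (hlam0 : ∀ s c, 0 ≤ lam s c) (hlamv : ∀ s c, 0 < lam s c → 2 * (c : ℝ) < t₁)
    (hkap0 : ∀ a c, 0 ≤ kap a c) (hkapv : ∀ a c, 0 < kap a c → 2 * (c : ℝ) < t₂)
    (hE0 : ∀ a ∈ Finset.range (M₁ + 1), ∀ s ∈ Finset.range (M₂ + 1),
      (∑ c ∈ Finset.range (M₁ + 1), lam s c *
          ((if t₁ - c ≤ (a : ℝ) then (1 : ℝ) else 0) - y / (1 - y) * (if a ≤ c then (1 : ℝ) else 0)))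
      + (∑ c ∈ Finset.range (M₂ + 1), kap a c *
          ((if t₂ - c ≤ (s : ℝ) then (1 : ℝ) else 0) - y / (1 - y) * (if s ≤ c then (1 : ℝ) else 0)))
      + ρ₁ s * ((a : ℝ) - t₁) + ρ₂ a * ((s : ℝ) - t₂)
      ≤ (if t₁ + t₂ - k ≤ ((a + s : ℕ) : ℝ) then (1 : ℝ) else 0) - y / (1 - y) * (if a + s ≤ k then (1 : ℝ) else 0))
    (hE1 : ∀ a ∈ Finset.range (M₁ + 1), ∀ s ∈ Finset.range (M₂ + 1),
      1 ≤ (∑ c ∈ Finset.range (M₁ + 1), lam s c) + (∑ c ∈ Finset.range (M₂ + 1), kap a c)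
          + (1 - y) / y * t₁ * ρ₁ s + (1 - y) / y * t₂ * ρ₂ a) :
    y / (1 - y) * ∑ h ∈ Finset.range (k + 1), gate (lconv M₁ M₂ μ₁ μ₂) q h
      ≤ ∑ h ∈ Finset.range (M₁ + M₂ + 1),
        (if t₁ + t₂ - k ≤ (h : ℝ) then gate (lconv M₁ M₂ μ₁ μ₂) q h else 0) := by
  -- test functions against a gated law (arm-2 g38's `sum_fun_mul_gate`, inlined while its module is unbuilt on the farm)
  have sum_gate_test : ∀ (Mx : ℕ) (μx : ℕ → ℝ) (φ : ℕ → ℝ),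
      ∑ h ∈ Finset.range (Mx + 1), φ h * gate μx q h = q * ∑ h ∈ Finset.range (Mx + 1), φ h * μx h + (1 - q) * φ 0 := by
    intro Mx μx φ; simp only [gate]
    have e : ∀ h : ℕ, φ h * (q * μx h + (if h = 0 then 1 - q else 0))
        = q * (φ h * μx h) + (if h = 0 then (1 - q) * φ 0 else 0) := by
      intro h; by_cases hh : h = 0 <;> simp [hh] <;> ring
    simp_rw [e]
    rw [Finset.sum_add_distrib, ← Finset.mul_sum, Finset.sum_ite_eq' (Finset.range (Mx + 1)) 0,
      if_pos (Finset.mem_range.2 (Nat.succ_pos Mx))]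
  -- a test function against the convolution (arm-2 g38's `sum_fun_mul_lconv`, inlined)
  have sum_lconv_test : ∀ φ : ℕ → ℝ, ∑ h ∈ Finset.range (M₁ + M₂ + 1), φ h * lconv M₁ M₂ μ₁ μ₂ h
      = ∑ a ∈ Finset.range (M₁ + 1), ∑ s ∈ Finset.range (M₂ + 1), φ (a + s) * (μ₁ a * μ₂ s) := by
    intro φ; simp only [lconv, Finset.mul_sum]; rw [Finset.sum_comm]
    refine Finset.sum_congr rfl fun a ha => ?_
    rw [Finset.sum_comm]
    refine Finset.sum_congr rfl fun s hs => ?_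
    rw [Finset.mem_range] at ha hs
    have e : ∀ h : ℕ, φ h * (if a + s = h then μ₁ a * μ₂ s else 0) = if a + s = h then φ (a + s) * (μ₁ a * μ₂ s) else 0 := by
      intro h; by_cases hh : a + s = h <;> simp [hh]
    simp_rw [e]
    rw [Finset.sum_ite_eq (Finset.range (M₁ + M₂ + 1)) (a + s), if_pos (Finset.mem_range.2 (by omega))]
  -- abbreviations
  set u : ℝ := y / (1 - y) with hu
  have hu0 : 0 < u := div_pos hy0 (by linarith)
  have hy0' : y ≠ 0 := ne_of_gt hy0
  have h1y : (1 - y) ≠ 0 := ne_of_gt (by linarith)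
  have hu' : u * ((1 - y) / y) = 1 := by
    rw [hu, div_mul_div_comm, mul_comm y (1 - y), div_self (mul_ne_zero h1y hy0')]
  set T₁ : ℝ := ∑ h ∈ Finset.range (M₁ + 1), (h : ℝ) * μ₁ h with hT₁
  set T₂ : ℝ := ∑ h ∈ Finset.range (M₂ + 1), (h : ℝ) * μ₂ h with hT₂
  set ν := lconv M₁ M₂ μ₁ μ₂ with hν
  set H₁ : ℕ → ℕ → ℝ := fun c a =>
    (if t₁ - c ≤ (a : ℝ) then (1 : ℝ) else 0) - u * (if a ≤ c then (1 : ℝ) else 0) with hH₁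
  set H₂ : ℕ → ℕ → ℝ := fun c s =>
    (if t₂ - c ≤ (s : ℝ) then (1 : ℝ) else 0) - u * (if s ≤ c then (1 : ℝ) else 0) with hH₂
  set K : ℕ → ℝ := fun n =>
    (if t₁ + t₂ - k ≤ (n : ℝ) then (1 : ℝ) else 0) - u * (if n ≤ k then (1 : ℝ) else 0) with hK
  -- (1) the factor rows in functional form: `u(1−q) ≤ q·E[H¹_c]` for valid `c`
  have hrow : ∀ c : ℕ, 2 * (c : ℝ) < t₁ → u * (1 - q) ≤ q * ∑ a ∈ Finset.range (M₁ + 1), μ₁ a * H₁ c a :=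
    fun c hc => gate_row_functional u q t₁ M₁ c μ₁ z1 hc (hB1 c hc)
  have hcol : ∀ c : ℕ, 2 * (c : ℝ) < t₂ → u * (1 - q) ≤ q * ∑ s ∈ Finset.range (M₂ + 1), μ₂ s * H₂ c s :=
    fun c hc => gate_row_functional u q t₂ M₂ c μ₂ z2 hc (hB2 c hc)
  -- weighted versions (zero weight or valid row)
  have hrow' : ∀ s c, lam s c * (u * (1 - q)) ≤ lam s c * (q * ∑ a ∈ Finset.range (M₁ + 1), μ₁ a * H₁ c a) := fun s c => by
    rcases (hlam0 s c).lt_or_eq with hpos | hzero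
    · exact mul_le_mul_of_nonneg_left (hrow c (hlamv s c hpos)) hpos.le
    · rw [← hzero, zero_mul, zero_mul]
  have hcol' : ∀ a c, kap a c * (u * (1 - q)) ≤ kap a c * (q * ∑ s ∈ Finset.range (M₂ + 1), μ₂ s * H₂ c s) := fun a c => by
    rcases (hkap0 a c).lt_or_eq with hpos | hzero
    · exact mul_le_mul_of_nonneg_left (hcol c (hkapv a c hpos)) hpos.le
    · rw [← hzero, zero_mul, zero_mul]
  -- (2) the tilts: `Σ_a μ₁ a (a − t₁) = T₁ − t₁ = (1−q) T₁`
  have htilt1 : ∑ a ∈ Finset.range (M₁ + 1), μ₁ a * ((a : ℝ) - t₁) = (1 - q) * T₁ := by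
    have : ∑ a ∈ Finset.range (M₁ + 1), μ₁ a * ((a : ℝ) - t₁)
        = ∑ a ∈ Finset.range (M₁ + 1), (a : ℝ) * μ₁ a - t₁ * ∑ a ∈ Finset.range (M₁ + 1), μ₁ a := by
      rw [Finset.mul_sum, ← Finset.sum_sub_distrib]
      exact Finset.sum_congr rfl fun a _ => by ring
    rw [this, s1, mul_one, ← hT₁, ht1]; ring
  have htilt2 : ∑ s ∈ Finset.range (M₂ + 1), μ₂ s * ((s : ℝ) - t₂) = (1 - q) * T₂ := by
    have : ∑ s ∈ Finset.range (M₂ + 1), μ₂ s * ((s : ℝ) - t₂)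
        = ∑ s ∈ Finset.range (M₂ + 1), (s : ℝ) * μ₂ s - t₂ * ∑ s ∈ Finset.range (M₂ + 1), μ₂ s := by
      rw [Finset.mul_sum, ← Finset.sum_sub_distrib]
      exact Finset.sum_congr rfl fun s _ => by ring
    rw [this, s2, mul_one, ← hT₂, ht2]; ring
  -- (3) integrate (E0) against `μ₁ a μ₂ s ≥ 0`
  have hint : ∑ a ∈ Finset.range (M₁ + 1), ∑ s ∈ Finset.range (M₂ + 1), (μ₁ a * μ₂ s) *
      ((∑ c ∈ Finset.range (M₁ + 1), lam s c * H₁ c a) + (∑ c ∈ Finset.range (M₂ + 1), kap a c * H₂ c s)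
        + ρ₁ s * ((a : ℝ) - t₁) + ρ₂ a * ((s : ℝ) - t₂))
      ≤ ∑ a ∈ Finset.range (M₁ + 1), ∑ s ∈ Finset.range (M₂ + 1), K (a + s) * (μ₁ a * μ₂ s) := by
    refine Finset.sum_le_sum fun a ha => Finset.sum_le_sum fun s hs => ?_
    rw [mul_comm (K (a + s))]
    have hc := hE0 a ha s hs
    have e : K (a + s) = (if t₁ + t₂ - k ≤ ((a + s : ℕ) : ℝ) then (1 : ℝ) else 0) - u * (if a + s ≤ k then (1 : ℝ) else 0) := by
      simp only [hK]
    rw [e]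
    exact mul_le_mul_of_nonneg_left hc (mul_nonneg (n1 a) (n2 s))
  -- (4) split the integrand into its four parts and evaluate / bound each
  have e1 : ∀ a s, (μ₁ a * μ₂ s) *
      ((∑ c ∈ Finset.range (M₁ + 1), lam s c * H₁ c a) + (∑ c ∈ Finset.range (M₂ + 1), kap a c * H₂ c s)
        + ρ₁ s * ((a : ℝ) - t₁) + ρ₂ a * ((s : ℝ) - t₂))
      = μ₂ s * (μ₁ a * ∑ c ∈ Finset.range (M₁ + 1), lam s c * H₁ c a)
        + μ₁ a * (μ₂ s * ∑ c ∈ Finset.range (M₂ + 1), kap a c * H₂ c s)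
        + (μ₂ s * ρ₁ s) * (μ₁ a * ((a : ℝ) - t₁)) + (μ₁ a * ρ₂ a) * (μ₂ s * ((s : ℝ) - t₂)) := by
    intro a s; ring
  simp_rw [e1, Finset.sum_add_distrib] at hint
  -- part 3, part 4: tilts
  have p3 : ∑ a ∈ Finset.range (M₁ + 1), ∑ s ∈ Finset.range (M₂ + 1), (μ₂ s * ρ₁ s) * (μ₁ a * ((a : ℝ) - t₁))
      = (1 - q) * T₁ * ∑ s ∈ Finset.range (M₂ + 1), μ₂ s * ρ₁ s := by
    rw [Finset.sum_comm, Finset.mul_sum]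
    refine Finset.sum_congr rfl fun s _ => ?_
    rw [← Finset.mul_sum, htilt1]; ring
  have p4 : ∑ a ∈ Finset.range (M₁ + 1), ∑ s ∈ Finset.range (M₂ + 1), (μ₁ a * ρ₂ a) * (μ₂ s * ((s : ℝ) - t₂))
      = (1 - q) * T₂ * ∑ a ∈ Finset.range (M₁ + 1), μ₁ a * ρ₂ a := by
    rw [Finset.mul_sum]
    refine Finset.sum_congr rfl fun a _ => ?_
    rw [← Finset.mul_sum, htilt2]; ring
  -- part 1: rows, `u(1−q)·Σ_s μ₂ s Λ(s) ≤ q·part1`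
  have hR1 : ∑ a ∈ Finset.range (M₁ + 1), ∑ s ∈ Finset.range (M₂ + 1),
      μ₂ s * (μ₁ a * ∑ c ∈ Finset.range (M₁ + 1), lam s c * H₁ c a)
      = ∑ s ∈ Finset.range (M₂ + 1), μ₂ s * ∑ c ∈ Finset.range (M₁ + 1),
          lam s c * ∑ a ∈ Finset.range (M₁ + 1), μ₁ a * H₁ c a := by
    rw [Finset.sum_comm]
    refine Finset.sum_congr rfl fun s _ => ?_
    rw [← Finset.mul_sum]
    congr 1
    have : ∀ a ∈ Finset.range (M₁ + 1), μ₁ a * ∑ c ∈ Finset.range (M₁ + 1), lam s c * H₁ c a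
        = ∑ c ∈ Finset.range (M₁ + 1), lam s c * (μ₁ a * H₁ c a) := by
      intro a _; rw [Finset.mul_sum]; exact Finset.sum_congr rfl fun c _ => by ring
    rw [Finset.sum_congr rfl this, Finset.sum_comm]
    exact Finset.sum_congr rfl fun c _ => by rw [Finset.mul_sum]
  have p1c : ∀ s, u * (1 - q) * ∑ c ∈ Finset.range (M₁ + 1), lam s c
      ≤ q * ∑ c ∈ Finset.range (M₁ + 1), lam s c * ∑ a ∈ Finset.range (M₁ + 1), μ₁ a * H₁ c a := fun s => by
    rw [Finset.mul_sum, Finset.mul_sum]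
    exact Finset.sum_le_sum fun c _ => by have h := hrow' s c; linarith
  have p1 : u * (1 - q) * ∑ s ∈ Finset.range (M₂ + 1), μ₂ s * ∑ c ∈ Finset.range (M₁ + 1), lam s c
      ≤ q * ∑ a ∈ Finset.range (M₁ + 1), ∑ s ∈ Finset.range (M₂ + 1),
          μ₂ s * (μ₁ a * ∑ c ∈ Finset.range (M₁ + 1), lam s c * H₁ c a) := by
    rw [hR1, Finset.mul_sum, Finset.mul_sum]
    exact Finset.sum_le_sum fun s _ => by have h := mul_le_mul_of_nonneg_left (p1c s) (n2 s); linarith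
  -- part 2: columns
  have hR2 : ∑ a ∈ Finset.range (M₁ + 1), ∑ s ∈ Finset.range (M₂ + 1),
      μ₁ a * (μ₂ s * ∑ c ∈ Finset.range (M₂ + 1), kap a c * H₂ c s)
      = ∑ a ∈ Finset.range (M₁ + 1), μ₁ a * ∑ c ∈ Finset.range (M₂ + 1),
          kap a c * ∑ s ∈ Finset.range (M₂ + 1), μ₂ s * H₂ c s := by
    refine Finset.sum_congr rfl fun a _ => ?_
    rw [← Finset.mul_sum]
    congr 1
    have : ∀ s ∈ Finset.range (M₂ + 1), μ₂ s * ∑ c ∈ Finset.range (M₂ + 1), kap a c * H₂ c s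
        = ∑ c ∈ Finset.range (M₂ + 1), kap a c * (μ₂ s * H₂ c s) := by
      intro s _; rw [Finset.mul_sum]; exact Finset.sum_congr rfl fun c _ => by ring
    rw [Finset.sum_congr rfl this, Finset.sum_comm]
    exact Finset.sum_congr rfl fun c _ => by rw [Finset.mul_sum]
  have p2c : ∀ a, u * (1 - q) * ∑ c ∈ Finset.range (M₂ + 1), kap a c
      ≤ q * ∑ c ∈ Finset.range (M₂ + 1), kap a c * ∑ s ∈ Finset.range (M₂ + 1), μ₂ s * H₂ c s := fun a => by
    rw [Finset.mul_sum, Finset.mul_sum]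
    exact Finset.sum_le_sum fun c _ => by have h := hcol' a c; linarith
  have p2 : u * (1 - q) * ∑ a ∈ Finset.range (M₁ + 1), μ₁ a * ∑ c ∈ Finset.range (M₂ + 1), kap a c
      ≤ q * ∑ a ∈ Finset.range (M₁ + 1), ∑ s ∈ Finset.range (M₂ + 1),
          μ₁ a * (μ₂ s * ∑ c ∈ Finset.range (M₂ + 1), kap a c * H₂ c s) := by
    rw [hR2, Finset.mul_sum, Finset.mul_sum]
    exact Finset.sum_le_sum fun a _ => by have h := mul_le_mul_of_nonneg_left (p2c a) (n1 a); linarith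
  -- (5) the yield: integrate (E1) against `μ₁ a μ₂ s`
  have hyield : (1 : ℝ) ≤ ∑ s ∈ Finset.range (M₂ + 1), μ₂ s * ∑ c ∈ Finset.range (M₁ + 1), lam s c
      + ∑ a ∈ Finset.range (M₁ + 1), μ₁ a * ∑ c ∈ Finset.range (M₂ + 1), kap a c
      + (1 - y) / y * t₁ * ∑ s ∈ Finset.range (M₂ + 1), μ₂ s * ρ₁ s
      + (1 - y) / y * t₂ * ∑ a ∈ Finset.range (M₁ + 1), μ₁ a * ρ₂ a := by
    have hsum : ∑ a ∈ Finset.range (M₁ + 1), ∑ s ∈ Finset.range (M₂ + 1), μ₁ a * μ₂ s * (1 : ℝ)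
        ≤ ∑ a ∈ Finset.range (M₁ + 1), ∑ s ∈ Finset.range (M₂ + 1), μ₁ a * μ₂ s *
          ((∑ c ∈ Finset.range (M₁ + 1), lam s c) + (∑ c ∈ Finset.range (M₂ + 1), kap a c)
            + (1 - y) / y * t₁ * ρ₁ s + (1 - y) / y * t₂ * ρ₂ a) :=
      Finset.sum_le_sum fun a ha => Finset.sum_le_sum fun s hs =>
        mul_le_mul_of_nonneg_left (hE1 a ha s hs) (mul_nonneg (n1 a) (n2 s))
    have hone : ∑ a ∈ Finset.range (M₁ + 1), ∑ s ∈ Finset.range (M₂ + 1), μ₁ a * μ₂ s * (1 : ℝ) = 1 := by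
      simp_rw [mul_one]
      rw [← Finset.sum_mul_sum, s1, s2, mul_one]
    have e2 : ∀ a s, μ₁ a * μ₂ s *
        ((∑ c ∈ Finset.range (M₁ + 1), lam s c) + (∑ c ∈ Finset.range (M₂ + 1), kap a c)
          + (1 - y) / y * t₁ * ρ₁ s + (1 - y) / y * t₂ * ρ₂ a)
        = μ₁ a * (μ₂ s * ∑ c ∈ Finset.range (M₁ + 1), lam s c) + μ₂ s * (μ₁ a * ∑ c ∈ Finset.range (M₂ + 1), kap a c)
          + (1 - y) / y * t₁ * (μ₁ a * (μ₂ s * ρ₁ s)) + (1 - y) / y * t₂ * (μ₂ s * (μ₁ a * ρ₂ a)) := by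
      intro a s; ring
    simp_rw [e2, Finset.sum_add_distrib] at hsum
    rw [hone] at hsum
    have q1 : ∑ a ∈ Finset.range (M₁ + 1), ∑ s ∈ Finset.range (M₂ + 1), μ₁ a * (μ₂ s * ∑ c ∈ Finset.range (M₁ + 1), lam s c)
        = ∑ s ∈ Finset.range (M₂ + 1), μ₂ s * ∑ c ∈ Finset.range (M₁ + 1), lam s c := by
      rw [Finset.sum_comm]
      refine Finset.sum_congr rfl fun s _ => ?_
      rw [← Finset.sum_mul, s1, one_mul]
    have q2 : ∑ a ∈ Finset.range (M₁ + 1), ∑ s ∈ Finset.range (M₂ + 1), μ₂ s * (μ₁ a * ∑ c ∈ Finset.range (M₂ + 1), kap a c)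
        = ∑ a ∈ Finset.range (M₁ + 1), μ₁ a * ∑ c ∈ Finset.range (M₂ + 1), kap a c := by
      refine Finset.sum_congr rfl fun a _ => ?_
      rw [← Finset.sum_mul, s2, one_mul]
    have q3 : ∑ a ∈ Finset.range (M₁ + 1), ∑ s ∈ Finset.range (M₂ + 1), (1 - y) / y * t₁ * (μ₁ a * (μ₂ s * ρ₁ s))
        = (1 - y) / y * t₁ * ∑ s ∈ Finset.range (M₂ + 1), μ₂ s * ρ₁ s := by
      rw [Finset.sum_comm, Finset.mul_sum]
      refine Finset.sum_congr rfl fun s _ => ?_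
      rw [← Finset.mul_sum, ← Finset.sum_mul, s1, one_mul]
    have q4 : ∑ a ∈ Finset.range (M₁ + 1), ∑ s ∈ Finset.range (M₂ + 1), (1 - y) / y * t₂ * (μ₂ s * (μ₁ a * ρ₂ a))
        = (1 - y) / y * t₂ * ∑ a ∈ Finset.range (M₁ + 1), μ₁ a * ρ₂ a := by
      rw [Finset.mul_sum]
      refine Finset.sum_congr rfl fun a _ => ?_
      rw [← Finset.mul_sum, ← Finset.sum_mul, s2, one_mul]
    rw [q1, q2, q3, q4] at hsum
    exact hsum
  -- (6) the conclusion in functional form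
  have hzν : ∀ h, M₁ + M₂ < h → gate ν q h = 0 := fun h hh => by
    simp only [gate]; rw [hν, lconv_eq_zero M₁ M₂ μ₁ μ₂ h hh, if_neg (by omega)]; ring
  rw [sum_range_succ_eq_sum_ite (M₁ + M₂) k (gate ν q) hzν]
  have eL : ∑ h ∈ Finset.range (M₁ + M₂ + 1), (if h ≤ k then gate ν q h else 0)
      = ∑ h ∈ Finset.range (M₁ + M₂ + 1), (if h ≤ k then (1 : ℝ) else 0) * gate ν q h :=
    Finset.sum_congr rfl fun h _ => by split_ifs <;> simp
  have eR : ∑ h ∈ Finset.range (M₁ + M₂ + 1), (if t₁ + t₂ - k ≤ (h : ℝ) then gate ν q h else 0)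
      = ∑ h ∈ Finset.range (M₁ + M₂ + 1), (if t₁ + t₂ - k ≤ (h : ℝ) then (1 : ℝ) else 0) * gate ν q h :=
    Finset.sum_congr rfl fun h _ => by split_ifs <;> simp
  rw [eL, eR, sum_gate_test, sum_gate_test]
  simp only [Nat.cast_zero, Nat.zero_le, if_true]
  rw [if_neg (by linarith)]
  -- `Σ_h K h·ν h` as a double sum
  have hKν : ∑ h ∈ Finset.range (M₁ + M₂ + 1), K h * ν h
      = ∑ a ∈ Finset.range (M₁ + 1), ∑ s ∈ Finset.range (M₂ + 1), K (a + s) * (μ₁ a * μ₂ s) := by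
    rw [hν]; exact sum_lconv_test K
  have hKsplit : ∑ h ∈ Finset.range (M₁ + M₂ + 1), K h * ν h
      = ∑ h ∈ Finset.range (M₁ + M₂ + 1), (if t₁ + t₂ - k ≤ (h : ℝ) then (1 : ℝ) else 0) * ν h
        - u * ∑ h ∈ Finset.range (M₁ + M₂ + 1), (if h ≤ k then (1 : ℝ) else 0) * ν h := by
    rw [Finset.mul_sum, ← Finset.sum_sub_distrib]
    exact Finset.sum_congr rfl fun h _ => by rw [hK]; ring
  -- (7) assemble: `u(1−q) ≤ q·Σ K ν`
  have key : u * (1 - q) ≤ q * ∑ h ∈ Finset.range (M₁ + M₂ + 1), K h * ν h := by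
    rw [hKν]
    have hq1' : 0 ≤ 1 - q := by linarith
    have hA : u * (1 - q) * 1 ≤ u * (1 - q) *
        (∑ s ∈ Finset.range (M₂ + 1), μ₂ s * ∑ c ∈ Finset.range (M₁ + 1), lam s c
          + ∑ a ∈ Finset.range (M₁ + 1), μ₁ a * ∑ c ∈ Finset.range (M₂ + 1), kap a c
          + (1 - y) / y * t₁ * ∑ s ∈ Finset.range (M₂ + 1), μ₂ s * ρ₁ s
          + (1 - y) / y * t₂ * ∑ a ∈ Finset.range (M₁ + 1), μ₁ a * ρ₂ a) :=
      mul_le_mul_of_nonneg_left hyield (mul_nonneg hu0.le hq1')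
    -- the tilt parts: `u(1−q)·((1−y)/y)·tᵢ = (1−q)·q·Tᵢ` since `u(1−y)/y = 1` and `tᵢ = qTᵢ`
    have e3 : u * (1 - q) * ((1 - y) / y * t₁ * ∑ s ∈ Finset.range (M₂ + 1), μ₂ s * ρ₁ s)
        = q * ((1 - q) * T₁ * ∑ s ∈ Finset.range (M₂ + 1), μ₂ s * ρ₁ s) := by
      have : u * (1 - q) * ((1 - y) / y * t₁ * ∑ s ∈ Finset.range (M₂ + 1), μ₂ s * ρ₁ s)
          = (u * ((1 - y) / y)) * ((1 - q) * t₁ * ∑ s ∈ Finset.range (M₂ + 1), μ₂ s * ρ₁ s) := by ring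
      rw [this, hu', one_mul, ht1]; ring
    have e4 : u * (1 - q) * ((1 - y) / y * t₂ * ∑ a ∈ Finset.range (M₁ + 1), μ₁ a * ρ₂ a)
        = q * ((1 - q) * T₂ * ∑ a ∈ Finset.range (M₁ + 1), μ₁ a * ρ₂ a) := by
      have : u * (1 - q) * ((1 - y) / y * t₂ * ∑ a ∈ Finset.range (M₁ + 1), μ₁ a * ρ₂ a)
          = (u * ((1 - y) / y)) * ((1 - q) * t₂ * ∑ a ∈ Finset.range (M₁ + 1), μ₁ a * ρ₂ a) := by ring
      rw [this, hu', one_mul, ht2]; ring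
    have hint' := mul_le_mul_of_nonneg_left hint hq0.le
    rw [p3, p4] at hint'
    have hA' : u * (1 - q) ≤
        u * (1 - q) * (∑ s ∈ Finset.range (M₂ + 1), μ₂ s * ∑ c ∈ Finset.range (M₁ + 1), lam s c)
        + u * (1 - q) * (∑ a ∈ Finset.range (M₁ + 1), μ₁ a * ∑ c ∈ Finset.range (M₂ + 1), kap a c)
        + u * (1 - q) * ((1 - y) / y * t₁ * ∑ s ∈ Finset.range (M₂ + 1), μ₂ s * ρ₁ s)
        + u * (1 - q) * ((1 - y) / y * t₂ * ∑ a ∈ Finset.range (M₁ + 1), μ₁ a * ρ₂ a) := by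
      have := hA; linarith
    rw [e3, e4] at hA'
    have hint'' : q * (∑ a ∈ Finset.range (M₁ + 1), ∑ s ∈ Finset.range (M₂ + 1),
          μ₂ s * (μ₁ a * ∑ c ∈ Finset.range (M₁ + 1), lam s c * H₁ c a))
        + q * (∑ a ∈ Finset.range (M₁ + 1), ∑ s ∈ Finset.range (M₂ + 1),
          μ₁ a * (μ₂ s * ∑ c ∈ Finset.range (M₂ + 1), kap a c * H₂ c s))
        + q * ((1 - q) * T₁ * ∑ s ∈ Finset.range (M₂ + 1), μ₂ s * ρ₁ s)
        + q * ((1 - q) * T₂ * ∑ a ∈ Finset.range (M₁ + 1), μ₁ a * ρ₂ a)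
        ≤ q * ∑ a ∈ Finset.range (M₁ + 1), ∑ s ∈ Finset.range (M₂ + 1), K (a + s) * (μ₁ a * μ₂ s) := by
      have := hint'; linarith
    linarith [hA', p1, p2, hint'']
  rw [hKsplit] at key
  linarith [key]

end LawDec

end Quant

end Summit.CriticalPhenomena.PercolationContinuityZ3.Theorems
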